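import Summits.ResolutionOfSingularities.ResolutionOfSingularities.Theorems.EquisingularLiftEquisingularLiftSingularVectorsCurrency
import Summits.ResolutionOfSingularities.ResolutionOfSingularities.Theorems.EquisingularLiftEquisingularLiftNatRouteCurrency
import HarnessLib

/-!
# [OURS] SINGULAR VECTORS ⟹ THE REGISTERED STUBS' OWN CURRENCY `ELNatConclusionO k n H ι`, FOR EVERY BINDER `(H, ι)` WITH `range ι = V₊(F)`
# (cruxes `Theses.EquisingularLift.EquisingularLiftNat` / `…NatThree`, stmt-ResolutionOfSingularities-20038 / -20148; every dimension)

[OURS · leafhand-res-equisingularlift-10 g1, 2026-08-31; cell `pub/decomp-res`] AI-produced, weaker than expert review; NOT a statement of any manuscript;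
nothing here proves resolution of singularities in positive characteristic.  DEF-FREE helper; no `sorry`; standard axioms; ZERO named hypotheses.

The registered residual stubs quantify over binders `(k, n, H, ι)` — `ι : H ⟶ ℙⁿ_k` a closed immersion, `H` integral, `ι` locally principal — and conclude
`ELNatConclusionO k n H ι`; hypothesis #7 of the isolated one is `¬ IsoHypPoint k n H ι`.  ✓ `isoHypPoint_of_singularVectors_oneStep_linAut` (p830488) and
✓ `elNatAt_of_singularVectors_{oneStep,firstOrder}_linAut` (p830590) speak about the coordinate model `(V₊(F), ι_F)`.  This file moves them to the binders:

* `isoHypPoint_of_range_eq_range` — **`IsoHypPoint k n H ι` depends on `(H, ι)` only through `range ι`** (the downstairs chain starts from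
  `(ℙⁿ_k, 𝟙, range ι)`; `H` itself never enters): equal ranges, equal hypothesis #7;
* ★★★ `isoHypPoint_of_range_eq_singularVectors_oneStep_linAut` / `…_firstOrder_…` — hypothesis #7 for EVERY binder `(H, ι)` with `range ι = V₊(F)`, `F` a
  prime form over `k = k̄` whose singular vectors are finitely many one-step / first-order points in per-point linear coordinates (polynomial data only);
* ★★★ `elnatO_of_range_eq_singularVectors_oneStep_linAut` / `…_firstOrder_…` — **the registered stubs' conclusion `ELNatConclusionO k (m+2) H ι` for every
  such binder** (✓ `elNatAt_of_isoHypPoint`, T-ISO-0; ✓ `RouteCurrency.elnatO_of_elNatAt`, the flat-text bridge).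

So, BY NAME: every instance `(p, k, m+2, H, ι)` of `stub_elnat_three_isolated_nonNDLeaves9` / of the parent's residues whose image is a hypersurface `V₊(F)`
with one-step singular vectors satisfies the stub's conclusion outright (and violates its hypothesis `¬ IsoHypPoint`).  Honest label: closes no registered
stub — the residues are about the `H` NOT of this kind.

References: [Hartshorne1977, I Thm. 5.1, II Example 7.1.1]; [Matsumura1987, Thm. 14.2]; [StacksProject, Tag 080E] — through the cited tree files.
-/

set_option linter.dupNamespace false -- mandated namespace `Summit.<Summit>.<Problem>` of this single-conjunct summit

noncomputable section

open CategoryTheory CategoryTheory.Limits AlgebraicGeometry TopologicalSpace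
open MvPolynomial HomogeneousLocalization
open Literature.AlgebraicGeometry.Resolution Literature.AlgebraicGeometry.Motives Literature.AlgebraicGeometry.GroupSchemes
open Literature.AlgebraicGeometry.Motives.SmoothHypersurface Literature.AlgebraicGeometry.Motives.ProjectiveSpace
open AlgebraicGeometry.Scheme.IdealSheafData
open Summit.ResolutionOfSingularities.ResolutionOfSingularities.Cruxes.EquisingularLift.StrataSplit
open Summit.ResolutionOfSingularities.ResolutionOfSingularities.Theorems.EquisingularLift

namespace Summit.ResolutionOfSingularities.ResolutionOfSingularities.Cruxes.EquisingularLiftNat.Sections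

/-- **`IsoHypPoint k n H ι` depends on `(H, ι)` only through `range ι`**: the downstairs point chain starts from the stage `(ℙⁿ_k, 𝟙, range ι)` and never
mentions `H` again. [OURS] [folklore] -/
theorem isoHypPoint_of_range_eq_range (k : Type) [Field k] [IsAlgClosed k] (n : ℕ) {H H' : Scheme.{0}}
    (ι : H ⟶ (projectiveSpace n k).left) (ι' : H' ⟶ (projectiveSpace n k).left) (h : Set.range ι = Set.range ι')
    (h' : IsoHypPoint k n H' ι') : IsoHypPoint k n H ι := by
  unfold IsoHypPoint at h' ⊢
  rw [h]
  exact h'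

section Binders

variable (K : Type) [Field K] [IsAlgClosed K] {m : ℕ} (F : MvPolynomial (Fin (m + 2 + 1)) K) {d : ℕ}
  (hF : F.IsHomogeneous d) (hFp : Prime F) (pts : List (GL (Fin (m + 2 + 1)) K × Fin (m + 2 + 1)))
  (hjac : ∀ b : Fin (m + 2 + 1) → K, b ≠ 0 → eval b F = 0 → (∀ i, eval b (pderiv i F) = 0) →
    ∃ gc ∈ pts, ∀ a : Fin (m + 2 + 1), a ≠ gc.2 →
      eval b (ProjLinAction.linSubst K (gc.1 : Matrix (Fin (m + 2 + 1)) (Fin (m + 2 + 1)) K) (X a)) = 0)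

include hF hFp hjac in
/-- ★★★ **Hypothesis #7 `IsoHypPoint` for EVERY binder `(H, ι)` with `range ι = V₊(F)`** — `F` a prime form over `K = K̄` whose singular vectors are one-step
points in per-point linear coordinates (data of ✓ `isoHypPoint_of_singularVectors_oneStep_linAut`). [OURS] [cite: Hartshorne1977, I Thm. 5.1, II Example 7.1.1] -/
theorem isoHypPoint_of_range_eq_singularVectors_oneStep_linAut
    (hone : ∀ gc ∈ pts,
      (ProjLinAction.linSubst K ((gc.1⁻¹ : GL (Fin (m + 2 + 1)) K) : Matrix (Fin (m + 2 + 1)) (Fin (m + 2 + 1)) K) F).IsHomogeneous d ∧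
      Prime (ProjLinAction.linSubst K ((gc.1⁻¹ : GL (Fin (m + 2 + 1)) K) : Matrix (Fin (m + 2 + 1)) (Fin (m + 2 + 1)) K) F) ∧
      ∃ (μ : ℕ) (Φ Ψ : MvPolynomial (Fin (m + 2)) K), 2 ≤ μ ∧ Φ.IsHomogeneous μ ∧ Φ ≠ 0 ∧
        Ψ ∈ Ideal.span (Set.range (X : Fin (m + 2) → MvPolynomial (Fin (m + 2)) K)) ^ (μ + 1) ∧
        ProjectiveSpace.dehomogenize K gc.2 (ProjLinAction.linSubst K ((gc.1⁻¹ : GL (Fin (m + 2 + 1)) K) :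
          Matrix (Fin (m + 2 + 1)) (Fin (m + 2 + 1)) K) F) = Φ + Ψ ∧
        ∀ l : Fin (m + 2), ∃ G : MvPolynomial (Fin (m + 2)) K,
          aeval (fun j => X l * Function.update (X : Fin (m + 2) → MvPolynomial (Fin (m + 2)) K) l 1 j) (Φ + Ψ) = X l ^ μ * G ∧
          ∀ P : Ideal (MvPolynomial (Fin (m + 2)) K), P.IsPrime → (X l : MvPolynomial (Fin (m + 2)) K) ∈ P → G ∈ P → ∃ j, pderiv j G ∉ P)
    {H : Scheme.{0}} (ι : H ⟶ (projectiveSpace (m + 2) K).left)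
    (hrange : letI := MvPolynomial.gradedAlgebra (σ := Fin (m + 2 + 1)) (R := K)
      Set.range ι = {x : Proj (homogeneousSubmodule (Fin (m + 2 + 1)) K) | F ∈ x.asHomogeneousIdeal}) :
    IsoHypPoint K (m + 2) H ι := by
  letI := MvPolynomial.gradedAlgebra (σ := Fin (m + 2 + 1)) (R := K)
  refine isoHypPoint_of_range_eq_range K (m + 2) ι (hypersurfaceι F).left ?_
    (isoHypPoint_of_singularVectors_oneStep_linAut K F hF hFp pts hone hjac)
  rw [hrange]
  exact (range_hypersurfaceι_setOf K F).symm

include hF hFp hjac in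
/-- ★★★ **Hypothesis #7 `IsoHypPoint` for every binder `(H, ι)` with `range ι = V₊(F)`, FIRST-ORDER data** (hand 9's intrinsic criterion in per-point
linear coordinates: ordinary multiple points, `A₂`, characteristic-2 nodes …). [OURS] [cite: Hartshorne1977, I Thm. 5.1, I Ex. 5.8] -/
theorem isoHypPoint_of_range_eq_singularVectors_firstOrder_linAut
    (hfo : ∀ gc ∈ pts,
      (ProjLinAction.linSubst K ((gc.1⁻¹ : GL (Fin (m + 2 + 1)) K) : Matrix (Fin (m + 2 + 1)) (Fin (m + 2 + 1)) K) F).IsHomogeneous d ∧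
      Prime (ProjLinAction.linSubst K ((gc.1⁻¹ : GL (Fin (m + 2 + 1)) K) : Matrix (Fin (m + 2 + 1)) (Fin (m + 2 + 1)) K) F) ∧
      ∃ (μ : ℕ) (Φ Ψ₁ Ψ' : MvPolynomial (Fin (m + 2)) K), 2 ≤ μ ∧ Φ.IsHomogeneous μ ∧ Φ ≠ 0 ∧ Ψ₁.IsHomogeneous (μ + 1) ∧
        Ψ' ∈ Ideal.span (Set.range (X : Fin (m + 2) → MvPolynomial (Fin (m + 2)) K)) ^ (μ + 2) ∧
        ProjectiveSpace.dehomogenize K gc.2 (ProjLinAction.linSubst K ((gc.1⁻¹ : GL (Fin (m + 2 + 1)) K) :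
          Matrix (Fin (m + 2 + 1)) (Fin (m + 2 + 1)) K) F) = Φ + (Ψ₁ + Ψ') ∧
        ∀ P : Ideal (MvPolynomial (Fin (m + 2)) K), P.IsPrime → Φ ∈ P → (∀ i, pderiv i Φ ∈ P) → Ψ₁ ∈ P →
          ∀ i, (X i : MvPolynomial (Fin (m + 2)) K) ∈ P)
    {H : Scheme.{0}} (ι : H ⟶ (projectiveSpace (m + 2) K).left)
    (hrange : letI := MvPolynomial.gradedAlgebra (σ := Fin (m + 2 + 1)) (R := K)
      Set.range ι = {x : Proj (homogeneousSubmodule (Fin (m + 2 + 1)) K) | F ∈ x.asHomogeneousIdeal}) :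
    IsoHypPoint K (m + 2) H ι := by
  letI := MvPolynomial.gradedAlgebra (σ := Fin (m + 2 + 1)) (R := K)
  refine isoHypPoint_of_range_eq_range K (m + 2) ι (hypersurfaceι F).left ?_
    (isoHypPoint_of_singularFirstOrderPoints_linAut K F hF hFp pts hfo
      (SingLocus.isRegularLocalRing_stalk_of_singularVectors_linAut K F hF hFp pts hjac))
  rw [hrange]
  exact (range_hypersurfaceι_setOf K F).symm

include hF hFp hjac in
/-- ★★★ **THE REGISTERED STUBS' CONCLUSION `ELNatConclusionO K (m+2) H ι` FOR EVERY BINDER WHOSE IMAGE IS A HYPERSURFACE WITH ONE-STEP SINGULAR VECTORS**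
(`K = K̄` of characteristic `p`; `ι` a locally principal closed immersion of the integral `H` with `range ι = V₊(F)`; polynomial data as in
✓ `isoHypPoint_of_singularVectors_oneStep_linAut`): hypothesis #7, then T-ISO-0 (✓ `elNatAt_of_isoHypPoint`) and the flat-text bridge
(✓ `RouteCurrency.elnatO_of_elNatAt`). [OURS] [cite: Hartshorne1977, I Thm. 5.1, II Example 7.1.1] [cite: StacksProject, Tag 080E] -/
theorem elnatO_of_range_eq_singularVectors_oneStep_linAut (p : ℕ) (hp : p.Prime) [CharP K p]
    (hone : ∀ gc ∈ pts,
      (ProjLinAction.linSubst K ((gc.1⁻¹ : GL (Fin (m + 2 + 1)) K) : Matrix (Fin (m + 2 + 1)) (Fin (m + 2 + 1)) K) F).IsHomogeneous d ∧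
      Prime (ProjLinAction.linSubst K ((gc.1⁻¹ : GL (Fin (m + 2 + 1)) K) : Matrix (Fin (m + 2 + 1)) (Fin (m + 2 + 1)) K) F) ∧
      ∃ (μ : ℕ) (Φ Ψ : MvPolynomial (Fin (m + 2)) K), 2 ≤ μ ∧ Φ.IsHomogeneous μ ∧ Φ ≠ 0 ∧
        Ψ ∈ Ideal.span (Set.range (X : Fin (m + 2) → MvPolynomial (Fin (m + 2)) K)) ^ (μ + 1) ∧
        ProjectiveSpace.dehomogenize K gc.2 (ProjLinAction.linSubst K ((gc.1⁻¹ : GL (Fin (m + 2 + 1)) K) :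
          Matrix (Fin (m + 2 + 1)) (Fin (m + 2 + 1)) K) F) = Φ + Ψ ∧
        ∀ l : Fin (m + 2), ∃ G : MvPolynomial (Fin (m + 2)) K,
          aeval (fun j => X l * Function.update (X : Fin (m + 2) → MvPolynomial (Fin (m + 2)) K) l 1 j) (Φ + Ψ) = X l ^ μ * G ∧
          ∀ P : Ideal (MvPolynomial (Fin (m + 2)) K), P.IsPrime → (X l : MvPolynomial (Fin (m + 2)) K) ∈ P → G ∈ P → ∃ j, pderiv j G ∉ P)
    {H : Scheme.{0}} (ι : H ⟶ (projectiveSpace (m + 2) K).left) (hι : IsClosedImmersion ι) (hH : IsIntegral H)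
    (hloc : ∀ y : (projectiveSpace (m + 2) K).left, ∃ U : (projectiveSpace (m + 2) K).left.affineOpens,
      y ∈ (U : (projectiveSpace (m + 2) K).left.Opens) ∧ (ι.ker.ideal U).IsPrincipal)
    (hrange : letI := MvPolynomial.gradedAlgebra (σ := Fin (m + 2 + 1)) (R := K)
      Set.range ι = {x : Proj (homogeneousSubmodule (Fin (m + 2 + 1)) K) | F ∈ x.asHomogeneousIdeal}) :
    ELNatConclusionO K (m + 2) H ι :=
  RouteCurrency.elnatO_of_elNatAt p hp K (m + 2) H ι hι hH
    (elNatAt_of_isoHypPoint p hp K (m + 2) H ι hι hH hloc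
      (isoHypPoint_of_range_eq_singularVectors_oneStep_linAut K F hF hFp pts hjac hone ι hrange))

include hF hFp hjac in
/-- ★★★ **The registered stubs' conclusion `ELNatConclusionO K (m+2) H ι` for every binder whose image is a hypersurface with FIRST-ORDER singular
vectors** (`K = K̄` of characteristic `p`). [OURS] [cite: Hartshorne1977, I Thm. 5.1, I Ex. 5.8] [cite: StacksProject, Tag 080E] -/
theorem elnatO_of_range_eq_singularVectors_firstOrder_linAut (p : ℕ) (hp : p.Prime) [CharP K p]
    (hfo : ∀ gc ∈ pts,
      (ProjLinAction.linSubst K ((gc.1⁻¹ : GL (Fin (m + 2 + 1)) K) : Matrix (Fin (m + 2 + 1)) (Fin (m + 2 + 1)) K) F).IsHomogeneous d ∧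
      Prime (ProjLinAction.linSubst K ((gc.1⁻¹ : GL (Fin (m + 2 + 1)) K) : Matrix (Fin (m + 2 + 1)) (Fin (m + 2 + 1)) K) F) ∧
      ∃ (μ : ℕ) (Φ Ψ₁ Ψ' : MvPolynomial (Fin (m + 2)) K), 2 ≤ μ ∧ Φ.IsHomogeneous μ ∧ Φ ≠ 0 ∧ Ψ₁.IsHomogeneous (μ + 1) ∧
        Ψ' ∈ Ideal.span (Set.range (X : Fin (m + 2) → MvPolynomial (Fin (m + 2)) K)) ^ (μ + 2) ∧
        ProjectiveSpace.dehomogenize K gc.2 (ProjLinAction.linSubst K ((gc.1⁻¹ : GL (Fin (m + 2 + 1)) K) :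
          Matrix (Fin (m + 2 + 1)) (Fin (m + 2 + 1)) K) F) = Φ + (Ψ₁ + Ψ') ∧
        ∀ P : Ideal (MvPolynomial (Fin (m + 2)) K), P.IsPrime → Φ ∈ P → (∀ i, pderiv i Φ ∈ P) → Ψ₁ ∈ P →
          ∀ i, (X i : MvPolynomial (Fin (m + 2)) K) ∈ P)
    {H : Scheme.{0}} (ι : H ⟶ (projectiveSpace (m + 2) K).left) (hι : IsClosedImmersion ι) (hH : IsIntegral H)
    (hloc : ∀ y : (projectiveSpace (m + 2) K).left, ∃ U : (projectiveSpace (m + 2) K).left.affineOpens,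
      y ∈ (U : (projectiveSpace (m + 2) K).left.Opens) ∧ (ι.ker.ideal U).IsPrincipal)
    (hrange : letI := MvPolynomial.gradedAlgebra (σ := Fin (m + 2 + 1)) (R := K)
      Set.range ι = {x : Proj (homogeneousSubmodule (Fin (m + 2 + 1)) K) | F ∈ x.asHomogeneousIdeal}) :
    ELNatConclusionO K (m + 2) H ι :=
  RouteCurrency.elnatO_of_elNatAt p hp K (m + 2) H ι hι hH
    (elNatAt_of_isoHypPoint p hp K (m + 2) H ι hι hH hloc
      (isoHypPoint_of_range_eq_singularVectors_firstOrder_linAut K F hF hFp pts hjac hfo ι hrange))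

end Binders

end Summit.ResolutionOfSingularities.ResolutionOfSingularities.Cruxes.EquisingularLiftNat.Sections

end
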